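import Mathlib
import Literature.MathematicalPhysics.QuantumFieldTheory.Balaban1983to89.B10SectAGathering
import Literature.MathematicalPhysics.QuantumFieldTheory.Balaban1983to89.Beta.GaussianIntegral

/-!
# `Balaban1983to89.B10Eq35Norm` — [Balaban1985UV3] (35) p. 265: the normalisation bound
# `|log Z^{(0)}(Ω₁, 1)/Z^{(0)}(T₁, 1)| ≤ O(1)|Ω₁ᶜ|` as a VOLUME LAW for Gaussian normalisations over nested variable
# sets — the common-core Schur-complement argument, kernel-checked, and the tree leaf `B10SectAGathering.Norm35`
# discharged modulo the located model hypotheses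

T. Bałaban, *Ultraviolet stability of three-dimensional lattice pure gauge field theories*, Commun. Math. Phys. **102**,
255–275 (1985) [Balaban1985UV3] (cell paper B10; PDF `paper:balaban1985-cmp102-uv-stability-3d`, journal page = PDF
page + 254).  Sibling of `…Balaban1983to89.B10SectAGathering`, which it imports and leaves untouched.  There the step
k → k + 1 of Theorem 2 is exponent bookkeeping over named leaves, one of which is

* `Norm35 P C := ∀ h, |P.logZ1 h − P.logZT| ≤ C · P.Zvol h` — at k = 0 the displayed bound **(35)** p. 265 [PDF 11]
  «We have to supplement also the constants in (22), involving log σ₀ and log g₀, to the whole lattice. Finally we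
  normalize log Z^{(0)}(Ω₁, U₁) subtracting and adding the term log Z^{(0)}(Ω₁, 1), which we have to supplement to the
  whole lattice using the bound (35) |log Z^{(0)}(Ω₁, 1)/Z^{(0)}(T₁, 1)| ≤ O(1)|Ω₁ᶜ|.» (ASSERTED, no proof in print;
  Z^{(0)}(T₁, 1) then enters «E^{(0)} = log σ₀|T₁*| + d(𝔤) log g₀|T₁*| + log Z^{(0)}(T₁, 1) + Σ_X 𝒫′₁(g₀, X, 1)»,
  same page); at k ≥ 1 the analogue `|log Z^{(k)}(B(Λ_{k+1}), 1) − log Z^{(k)}(T₁^{(k)}, 1)| ≤ O(1)|Z_k|` is NOT PRINTED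
  and used silently between (61) and (62) (cell GAPS G-B10-07 (a), G-B10-13 (a)).

The normalisation itself is only NAMED by the print — (22) p. 261 [PDF 7]: «× ∫dA↾_{Ω₁} δ(QA)δ_{Ax}(A)χ exp[v(g₀A) −
(1/g₀²)A(U₁) + ⟨D̃^{(2)}(A), J⟩ − ½⟨A, Δ(U₁)A⟩ − (1/g₀²)Ṽ₀(g₀A) − E + log σ₀|Ω₁*| + d(𝔤) log g₀|Ω₁*|] = Σ_{Ω₁} χ₁ ∫dV₀↾_{Ω₁ᶜ}
Π_{b′⊂Ω₁ᶜ} δ(V̄₀(b′)V⁻¹(b′))ζ_{Ω₁ᶜ} exp[−(1/g₀²)A(U₁) + log Z^{(0)}(Ω₁, U₁) − E + log σ₀|Ω₁*| + d(𝔤) log g₀|Ω₁*|] ×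
∫dμ_{C^{(0)}(Ω₁,U₁)}(A)χ exp[v(g₀A) − (1/g₀²)Ṽ(g₀A)]» and «The last integral above has the form ∫μχ exp V, where dμ is a
Gaussian measure with a covariance having an exponential decay property (and many other properties, see Sect. E in
[5])» — i.e. Z^{(0)}(Ω₁, U₁) is the normalisation of the constrained Gaussian `∫dA↾_{Ω₁} δ(QA)δ_{Ax}(A) exp[⟨D̃^{(2)}(A), J⟩
− ½⟨A, Δ(U₁)A⟩]` (cell GAPS G-B10-03: Ṽ, Z^{(0)}, C^{(0)} are not defined in the paper).

## What this module proves (all over `ℝ`, [folklore] linear algebra; nothing of the series is asserted)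

The argument certified in prose by the cell's adversarial reader (GAPS C-adv9-28 (b), correcting the reason recorded in
G-adv5-2): both normalisations are Gaussian integrals of ONE positive form with uniform spectral bounds `[c, a]`,
`0 < c`, over NESTED sets of variables sharing a common core (the whole-lattice constrained fields supported in the
small domain); integrating out the extra variables of either side replaces the form by a SCHUR COMPLEMENT, whose
spectrum stays in `[c, a]`; hence each extra variable costs at most `½(log 2π + max(|log c|, |log a|))`, and the number
of extra variables is a volume of the complement — the printed `O(1)|Ω₁ᶜ|`, with no locality of `log det` needed.

* §1 `le_eigenvalues_of_le_form`, `eigenvalues_le_of_form_le`, `pow_le_det_of_le_form`, `det_le_pow_of_form_le`,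
  `abs_log_det_le_of_form_bounds`: a symmetric `S` with `c‖y‖² ≤ ⟨y, Sy⟩ ≤ a‖y‖²` (`0 < c`) has
  `c^{|n|} ≤ det S ≤ a^{|n|}` and `|log det S| ≤ |n|·max(|log c|, |log a|)`.
* §2 `fromBlocks_mulVec_schurVec`, `le_form_schur₁₁`, `form_schur₁₁_le`: for the symmetric block matrix
  `Q = [[A, B], [Bᴴ, D]]` with `A ≻ 0` (the core block) the Schur complement `S = D − Bᴴ A⁻¹ B` inherits the lower
  form bound of `Q` (test vector `(−A⁻¹By) ⊕ y`, on which `Q` acts as `0 ⊕ Sy`) and the upper form bound of `D`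
  (`Bᴴ A⁻¹ B ⪰ 0`).  (The lower half is the ₁₁-mirror of `T4CollarDeterminant.schur_sub_smul_one_posSemidef` (₂₂ form,
  unit pv06); it is re-derived here by the direct computation so that this B10 leaf does not import the T4 chain.)
* §3 `det_fromBlocks₁₁_eq`, `abs_log_det_fromBlocks_sub_log_det_le`: `det Q = det A · det S` (Mathlib
  `Matrix.det_fromBlocks₁₁`), hence `|log det Q − log det A| ≤ |n|·max(|log c|, |log a|)` under `Q ⪰ c·1`,
  `D ⪯ a·1`.
* §4 `abs_log_gaussian_fromBlocks_sub_le`, `abs_log_gaussian_sub_le_of_commonCore`: with the tree's measure-theoretic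
  Gaussian integral `Beta.GaussianIntegral.log_integral_exp_neg_half_quadForm`
  (`log ∫ e^{−½⟨v,Qv⟩}dv = (|ι|/2) log 2π − ½ log det Q`):
  `|log ∫ e^{−½⟨v,Qv⟩}dv − log ∫ e^{−½⟨x,Ax⟩}dx| ≤ |n|·½(log 2π + max(|log c|, |log a|))` — a VOLUME LAW in the
  integrated-out variables — and its two-sided version for `Q₁ = [[K, B₁], [B₁ᴴ, D₁]]`, `Q₂ = [[K, B₂], [B₂ᴴ, D₂]]`
  sharing the core `K` (C-adv9-28 (b)'s `V′_T`): `≤ (|n₁| + |n₂|)·½(log 2π + max(|log c|, |log a|))`.  This is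
  complementary to, and does not restate, the PERIMETER (collar) law `T4CollarDeterminant.collarRatio_bounds` and the
  OSCILLATION law `T4LogDetOscillation.abs_log_det_sub_log_det_le` of the T4 sub-cell (both compare normalisations of
  the SAME dimension or a product splitting; here the variable sets are nested and differ by a volume).
* §5 `Norm35Model`, `norm35_of_model`: the B10-facing discharge.  IF, for every level-(k+1) history `h`, the two printed
  numbers `log Z^{(k)}(B(Λ_{k+1}), 1)` (`P.logZ1 h`) and `log Z^{(k)}(T₁^{(k)}, 1)` (`P.logZT`) ARE (a constant `J` from
  the δ-function constraint elimination) + (the log-Gaussian of common-core block forms as in §4) with form bounds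
  `[c, a]` UNIFORM in `h` (C-adv9-28's named LEAF: the lower bound is the positivity of the constrained quadratic form,
  [Balaban1985BackgroundPropagators] Thm. 3.11 p. 416 — cell GAPS G-B9-06/06a, tree `B9Thm311` for its Schur step; the
  upper bound is the boundedness of the difference operator `Δ(1)`), the number of non-core variables is `≤ c_v·|Z_k|`
  and the Jacobian constants differ by `≤ c_J·|Z_k|` (both UNPRINTED COUNTS, cell GAPS G-B10-07 (a): non-core variables
  and extra constraints sit on bonds of the complement and on coarse bonds meeting its boundary, a union of big blocks),
  THEN `Norm35 P (c_v·(log 2π + max(|log c|, |log a|))/2 + c_J)`.  The identification, the bounds and the counts are the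
  fields of `Norm35Model` = HYPOTHESES; the theorem is the printed-but-unproved inequality (35) given them.

CITATION HEADER (lean-in-tree rule 2026-08-18).  WHAT IS REPRODUCED: (35) and the sentences of p. 265 and (22) /
the sentence of p. 261 quoted «…» above, read on the page renders `pub-balaban/b2b-balaban-ref1/pages/1985-cmp102-uv-
stability-3d/…-p007-x2.png`, `…-p011-x2.png` as images (p. 264 = `…-p010-x2.png` carries (31)–(34); the cell rows
G-adv5-2 / C-adv9-28 locate (35) one page early).  NOTHING of the series is asserted: no cited facts, no new named
facts; every hypothesis is a binder or a field of `Norm35Model`; every `theorem` is [folklore] real linear algebra /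
calculus or the bookkeeping re-derivation its docstring names.  Value = kernel certificate of a displayed-but-unproved
bookkeeping bound modulo located leaves, NOT summit progress (d = 3 paper; nothing here bears on the d = 4 continuum
limit).  Unit `b2b-balaban-b10-g14` (PAPER SUB-CELL B10 gen 14); cell records GAPS C-b10g14-1 (kernel execution of
C-adv9-28 (b)), DIVERGENCE D-b10.18.
-/

noncomputable section

open Matrix Real MeasureTheory

namespace Literature.MathematicalPhysics.QuantumFieldTheory.Balaban1983to89.B10Eq35Norm

open Literature.MathematicalPhysics.QuantumFieldTheory.Balaban1983to89.B10
open Literature.MathematicalPhysics.QuantumFieldTheory.Balaban1983to89.B10SectAGathering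
open Literature.MathematicalPhysics.QuantumFieldTheory.Balaban1983to89.Beta

/-! ## §1. Form bounds ⇒ eigenvalue, determinant and log-determinant sandwich -/

section Sandwich

variable {n : Type*} [Fintype n] [DecidableEq n]

/-- The unit eigenvectors of the spectral theorem have `⟨u, u⟩ = 1`. [folklore] -/
theorem eigenvectorBasis_dotProduct_self {S : Matrix n n ℝ} (hS : S.IsHermitian) (i : n) :
    (⇑(hS.eigenvectorBasis i) : n → ℝ) ⬝ᵥ ⇑(hS.eigenvectorBasis i) = 1 := by
  have h1 := hS.eigenvectorBasis.orthonormal.1 i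
  rw [EuclideanSpace.norm_eq, Real.sqrt_eq_one] at h1
  simpa [dotProduct, pow_two] using h1

/-- A lower Rayleigh bound bounds every eigenvalue from below: `(∀ y, c‖y‖² ≤ ⟨y, Sy⟩) → c ≤ λ_i`. [folklore] -/
theorem le_eigenvalues_of_le_form {S : Matrix n n ℝ} (hS : S.IsHermitian) {c : ℝ}
    (h : ∀ y : n → ℝ, c * (y ⬝ᵥ y) ≤ y ⬝ᵥ (S *ᵥ y)) (i : n) : c ≤ hS.eigenvalues i := by
  have hu := eigenvectorBasis_dotProduct_self hS i
  rw [hS.eigenvalues_eq i, RCLike.re_to_real, star_trivial]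
  calc c = c * ((⇑(hS.eigenvectorBasis i) : n → ℝ) ⬝ᵥ ⇑(hS.eigenvectorBasis i)) := by rw [hu, mul_one]
    _ ≤ _ := h _

/-- An upper Rayleigh bound bounds every eigenvalue from above: `(∀ y, ⟨y, Sy⟩ ≤ a‖y‖²) → λ_i ≤ a`
(cf. `B13Sqrt27.eigenvalues_le_of_form_le`, same statement; repeated so that this leaf's imports stay minimal).
[folklore] -/
theorem eigenvalues_le_of_form_le {S : Matrix n n ℝ} (hS : S.IsHermitian) {a : ℝ}
    (h : ∀ y : n → ℝ, y ⬝ᵥ (S *ᵥ y) ≤ a * (y ⬝ᵥ y)) (i : n) : hS.eigenvalues i ≤ a := by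
  have hu := eigenvectorBasis_dotProduct_self hS i
  rw [hS.eigenvalues_eq i, RCLike.re_to_real, star_trivial]
  calc _ ≤ a * ((⇑(hS.eigenvectorBasis i) : n → ℝ) ⬝ᵥ ⇑(hS.eigenvectorBasis i)) := h _
    _ = a := by rw [hu, mul_one]

/-- `c^{|n|} ≤ det S` for symmetric `S` with `c‖y‖² ≤ ⟨y, Sy⟩`, `0 ≤ c`. [folklore] -/
theorem pow_le_det_of_le_form {S : Matrix n n ℝ} (hS : S.IsHermitian) {c : ℝ} (hc : 0 ≤ c)
    (h : ∀ y : n → ℝ, c * (y ⬝ᵥ y) ≤ y ⬝ᵥ (S *ᵥ y)) : c ^ Fintype.card n ≤ S.det := by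
  have hdet : S.det = ∏ i, hS.eigenvalues i := by simpa using hS.det_eq_prod_eigenvalues
  rw [hdet]
  calc c ^ Fintype.card n = ∏ _i : n, c := by rw [Finset.prod_const, Finset.card_univ]
    _ ≤ ∏ i, hS.eigenvalues i :=
        Finset.prod_le_prod (fun _ _ => hc) (fun i _ => le_eigenvalues_of_le_form hS h i)

omit [DecidableEq n] in
/-- A lower Rayleigh bound with `0 < c` makes `S` positive definite. [folklore] -/
theorem posDef_of_le_form {S : Matrix n n ℝ} (hS : S.IsHermitian) {c : ℝ} (hc : 0 < c)
    (h : ∀ y : n → ℝ, c * (y ⬝ᵥ y) ≤ y ⬝ᵥ (S *ᵥ y)) : S.PosDef := by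
  refine PosDef.of_dotProduct_mulVec_pos hS fun y hy => ?_
  have hyy : 0 < star y ⬝ᵥ y := dotProduct_star_self_pos_iff.mpr hy
  rw [star_trivial] at hyy ⊢
  exact (mul_pos hc hyy).trans_le (h y)

/-- `det S ≤ a^{|n|}` for symmetric `S` with `c‖y‖² ≤ ⟨y, Sy⟩ ≤ a‖y‖²`, `0 ≤ c`. [folklore] -/
theorem det_le_pow_of_form_le {S : Matrix n n ℝ} (hS : S.IsHermitian) {c a : ℝ} (hc : 0 ≤ c)
    (hlo : ∀ y : n → ℝ, c * (y ⬝ᵥ y) ≤ y ⬝ᵥ (S *ᵥ y)) (hhi : ∀ y : n → ℝ, y ⬝ᵥ (S *ᵥ y) ≤ a * (y ⬝ᵥ y)) :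
    S.det ≤ a ^ Fintype.card n := by
  have hdet : S.det = ∏ i, hS.eigenvalues i := by simpa using hS.det_eq_prod_eigenvalues
  rw [hdet]
  calc ∏ i, hS.eigenvalues i ≤ ∏ _i : n, a :=
        Finset.prod_le_prod (fun i _ => hc.trans (le_eigenvalues_of_le_form hS hlo i))
          (fun i _ => eigenvalues_le_of_form_le hS hhi i)
    _ = a ^ Fintype.card n := by rw [Finset.prod_const, Finset.card_univ]

/-- `0 < det S` under a positive lower Rayleigh bound. [folklore] -/
theorem det_pos_of_le_form {S : Matrix n n ℝ} (hS : S.IsHermitian) {c : ℝ} (hc : 0 < c)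
    (h : ∀ y : n → ℝ, c * (y ⬝ᵥ y) ≤ y ⬝ᵥ (S *ᵥ y)) : 0 < S.det :=
  (pow_pos hc _).trans_le (pow_le_det_of_le_form hS hc.le h)

/-- **Log-determinant sandwich.**  A symmetric `S` with `c‖y‖² ≤ ⟨y, Sy⟩ ≤ a‖y‖²`, `0 < c`, has
`|log det S| ≤ |n| · max(|log c|, |log a|)` — each of the `|n|` eigenvalues contributes a logarithm in
`[log c, log a]`. [folklore] -/
theorem abs_log_det_le_of_form_bounds {S : Matrix n n ℝ} (hS : S.IsHermitian) {c a : ℝ} (hc : 0 < c)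
    (hlo : ∀ y : n → ℝ, c * (y ⬝ᵥ y) ≤ y ⬝ᵥ (S *ᵥ y)) (hhi : ∀ y : n → ℝ, y ⬝ᵥ (S *ᵥ y) ≤ a * (y ⬝ᵥ y)) :
    |Real.log S.det| ≤ Fintype.card n * max |Real.log c| |Real.log a| := by
  have hlow := pow_le_det_of_le_form hS hc.le hlo
  have hup := det_le_pow_of_form_le hS hc.le hlo hhi
  have hcpow : 0 < c ^ Fintype.card n := pow_pos hc _
  have hdetpos : 0 < S.det := hcpow.trans_le hlow
  have hN : (0 : ℝ) ≤ Fintype.card n := Nat.cast_nonneg _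
  rw [abs_le]
  constructor
  · have h1 : (Fintype.card n : ℝ) * Real.log c ≤ Real.log S.det := by
      rw [← Real.log_pow]; exact Real.log_le_log hcpow hlow
    have h2 : -(max |Real.log c| |Real.log a|) ≤ Real.log c := by
      have := neg_abs_le (Real.log c)
      have := le_max_left |Real.log c| |Real.log a|
      linarith
    have h3 := mul_le_mul_of_nonneg_left h2 hN
    linarith
  · have h1 : Real.log S.det ≤ Fintype.card n * Real.log a := by
      rw [← Real.log_pow]; exact Real.log_le_log hdetpos hup
    have h2 : Real.log a ≤ max |Real.log c| |Real.log a| := (le_abs_self _).trans (le_max_right _ _)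
    have h3 := mul_le_mul_of_nonneg_left h2 hN
    linarith

/-- Loewner form `Q − c·1 ⪰ 0` ⇒ the Rayleigh form `c‖v‖² ≤ ⟨v, Qv⟩`. [folklore] -/
theorem le_form_of_sub_smul_one_posSemidef {Q : Matrix n n ℝ} {c : ℝ}
    (h : (Q - c • (1 : Matrix n n ℝ)).PosSemidef) (v : n → ℝ) : c * (v ⬝ᵥ v) ≤ v ⬝ᵥ (Q *ᵥ v) := by
  have hq := h.dotProduct_mulVec_nonneg v
  rw [star_trivial, sub_mulVec, dotProduct_sub, Matrix.smul_mulVec, one_mulVec, dotProduct_smul,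
    smul_eq_mul] at hq
  linarith

/-- Loewner form `a·1 − Q ⪰ 0` ⇒ the Rayleigh form `⟨v, Qv⟩ ≤ a‖v‖²`. [folklore] -/
theorem form_le_of_smul_one_sub_posSemidef {Q : Matrix n n ℝ} {a : ℝ}
    (h : (a • (1 : Matrix n n ℝ) - Q).PosSemidef) (v : n → ℝ) : v ⬝ᵥ (Q *ᵥ v) ≤ a * (v ⬝ᵥ v) := by
  have hq := h.dotProduct_mulVec_nonneg v
  rw [star_trivial, sub_mulVec, dotProduct_sub, Matrix.smul_mulVec, one_mulVec, dotProduct_smul,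
    smul_eq_mul] at hq
  linarith

omit [Fintype n] in
/-- `Q − c·1 ⪰ 0` carries the symmetry of `Q`. [folklore] -/
theorem isHermitian_of_sub_smul_one_posSemidef {Q : Matrix n n ℝ} {c : ℝ}
    (h : (Q - c • (1 : Matrix n n ℝ)).PosSemidef) : Q.IsHermitian := by
  have h1 : Q = (Q - c • 1) + c • (1 : Matrix n n ℝ) := by rw [sub_add_cancel]
  rw [h1]
  refine h.1.add ?_
  change (c • (1 : Matrix n n ℝ))ᴴ = c • 1
  rw [conjTranspose_smul, conjTranspose_one, star_trivial]

end Sandwich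

/-! ## §2. The Schur complement of the core block inherits the form bounds -/

section Schur

variable {m n : Type*} [Fintype m] [Fintype n] [DecidableEq m] [DecidableEq n]

omit [DecidableEq n] in
/-- The direct computation behind the Schur complement: on the test vector `(−A⁻¹By) ⊕ y` the block matrix
`[[A, B], [C, D]]` acts as `0 ⊕ (D − C A⁻¹ B)y`. [folklore] -/
theorem fromBlocks_mulVec_schurVec {A : Matrix m m ℝ} (hA : IsUnit A.det) (B : Matrix m n ℝ)
    (C : Matrix n m ℝ) (D : Matrix n n ℝ) (y : n → ℝ) :
    fromBlocks A B C D *ᵥ Sum.elim (-((A⁻¹ * B) *ᵥ y)) y = Sum.elim (0 : m → ℝ) ((D - C * A⁻¹ * B) *ᵥ y) := by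
  rw [fromBlocks_mulVec, Sum.elim_comp_inl, Sum.elim_comp_inr]
  congr 1
  · rw [mulVec_neg, mulVec_mulVec, Matrix.mul_nonsing_inv_cancel_left (A := A) B hA, neg_add_cancel]
  · rw [mulVec_neg, mulVec_mulVec, sub_mulVec, Matrix.mul_assoc, neg_add_eq_sub]

omit [DecidableEq m] [DecidableEq n] in
/-- `⟨x ⊕ y, x ⊕ y⟩ = ⟨x, x⟩ + ⟨y, y⟩ ≥ ⟨y, y⟩`. [folklore] -/
theorem dotProduct_sumElim_self (x : m → ℝ) (y : n → ℝ) :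
    Sum.elim x y ⬝ᵥ Sum.elim x y = x ⬝ᵥ x + y ⬝ᵥ y :=
  sumElim_dotProduct_sumElim x x y y

omit [DecidableEq n] in
/-- **Lower bound passes to the Schur complement (₁₁ form).**  If `Q = [[A, B], [Bᴴ, D]]` satisfies
`c‖v‖² ≤ ⟨v, Qv⟩` (`0 ≤ c`) and the core block `A` is positive definite, then
`c‖y‖² ≤ ⟨y, (D − Bᴴ A⁻¹ B)y⟩`: evaluate `Q` on `(−A⁻¹By) ⊕ y`, where it equals `⟨y, Sy⟩`, and drop `‖A⁻¹By‖² ≥ 0`.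
(₂₂ mirror: `T4CollarDeterminant.schur_sub_smul_one_posSemidef`.) [folklore] -/
theorem le_form_schur₁₁ {A : Matrix m m ℝ} (hA : A.PosDef) (B : Matrix m n ℝ) (D : Matrix n n ℝ) {c : ℝ}
    (hc : 0 ≤ c) (hQ : ∀ v : m ⊕ n → ℝ, c * (v ⬝ᵥ v) ≤ v ⬝ᵥ (fromBlocks A B Bᴴ D *ᵥ v)) (y : n → ℝ) :
    c * (y ⬝ᵥ y) ≤ y ⬝ᵥ ((D - Bᴴ * A⁻¹ * B) *ᵥ y) := by
  have hAu : IsUnit A.det := (isUnit_iff_isUnit_det A).mp hA.isUnit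
  have hQv := hQ (Sum.elim (-((A⁻¹ * B) *ᵥ y)) y)
  rw [fromBlocks_mulVec_schurVec hAu B Bᴴ D y, sumElim_dotProduct_sumElim, sumElim_dotProduct_sumElim,
    dotProduct_zero, zero_add] at hQv
  have hxx : 0 ≤ c * (-((A⁻¹ * B) *ᵥ y) ⬝ᵥ -((A⁻¹ * B) *ᵥ y)) :=
    mul_nonneg hc (by simpa only [star_trivial] using dotProduct_star_self_nonneg (-((A⁻¹ * B) *ᵥ y)))
  linarith

omit [DecidableEq n] in
/-- **Upper bound passes to the Schur complement (₁₁ form).**  If `⟨y, Dy⟩ ≤ a‖y‖²` and `A ≻ 0`, then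
`⟨y, (D − Bᴴ A⁻¹ B)y⟩ ≤ a‖y‖²`, because `Bᴴ A⁻¹ B ⪰ 0`. [folklore] -/
theorem form_schur₁₁_le {A : Matrix m m ℝ} (hA : A.PosDef) (B : Matrix m n ℝ) (D : Matrix n n ℝ) {a : ℝ}
    (hD : ∀ y : n → ℝ, y ⬝ᵥ (D *ᵥ y) ≤ a * (y ⬝ᵥ y)) (y : n → ℝ) :
    y ⬝ᵥ ((D - Bᴴ * A⁻¹ * B) *ᵥ y) ≤ a * (y ⬝ᵥ y) := by
  have hW : (Bᴴ * A⁻¹ * B).PosSemidef := hA.inv.posSemidef.conjTranspose_mul_mul_same B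
  have h0 : 0 ≤ y ⬝ᵥ ((Bᴴ * A⁻¹ * B) *ᵥ y) := by
    simpa only [star_trivial] using hW.dotProduct_mulVec_nonneg y
  rw [sub_mulVec, dotProduct_sub]
  linarith [hD y]

omit [DecidableEq m] [DecidableEq n] in
/-- Restriction of an upper form bound to the second block: `⟨v, Qv⟩ ≤ a‖v‖²` on `m ⊕ n` gives
`⟨y, Dy⟩ ≤ a‖y‖²` (test vector `0 ⊕ y`). [folklore] -/
theorem form₂₂_le_of_form_le (A : Matrix m m ℝ) (B : Matrix m n ℝ) (C : Matrix n m ℝ) (D : Matrix n n ℝ)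
    {a : ℝ} (hQ : ∀ v : m ⊕ n → ℝ, v ⬝ᵥ (fromBlocks A B C D *ᵥ v) ≤ a * (v ⬝ᵥ v)) (y : n → ℝ) :
    y ⬝ᵥ (D *ᵥ y) ≤ a * (y ⬝ᵥ y) := by
  have h := hQ (Sum.elim 0 y)
  rw [fromBlocks_mulVec, Sum.elim_comp_inl, Sum.elim_comp_inr, mulVec_zero, mulVec_zero, zero_add, zero_add,
    sumElim_dotProduct_sumElim, sumElim_dotProduct_sumElim, zero_dotProduct, zero_dotProduct, zero_add,
    zero_add] at h
  exact h

omit [DecidableEq m] [DecidableEq n] in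
/-- Restriction of a lower form bound to the first (core) block: `c‖v‖² ≤ ⟨v, Qv⟩` on `m ⊕ n` gives
`c‖x‖² ≤ ⟨x, Ax⟩` (test vector `x ⊕ 0`). [folklore] -/
theorem le_form₁₁_of_le_form (A : Matrix m m ℝ) (B : Matrix m n ℝ) (C : Matrix n m ℝ) (D : Matrix n n ℝ)
    {c : ℝ} (hQ : ∀ v : m ⊕ n → ℝ, c * (v ⬝ᵥ v) ≤ v ⬝ᵥ (fromBlocks A B C D *ᵥ v)) (x : m → ℝ) :
    c * (x ⬝ᵥ x) ≤ x ⬝ᵥ (A *ᵥ x) := by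
  have h := hQ (Sum.elim x 0)
  rw [fromBlocks_mulVec, Sum.elim_comp_inl, Sum.elim_comp_inr, mulVec_zero, mulVec_zero, add_zero, add_zero,
    sumElim_dotProduct_sumElim, sumElim_dotProduct_sumElim, zero_dotProduct, zero_dotProduct, add_zero,
    add_zero] at h
  exact h

/-- Under `Q = [[A, B], [Bᴴ, D]] ⪰ c·1` with `0 < c` the core block `A` is positive definite. [folklore] -/
theorem posDef₁₁_of_sub_smul_one_posSemidef {A : Matrix m m ℝ} {B : Matrix m n ℝ} {D : Matrix n n ℝ} {c : ℝ}
    (hc : 0 < c) (hQ : (fromBlocks A B Bᴴ D - c • (1 : Matrix (m ⊕ n) (m ⊕ n) ℝ)).PosSemidef) : A.PosDef :=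
  posDef_of_le_form (isHermitian_fromBlocks_iff.mp (isHermitian_of_sub_smul_one_posSemidef hQ)).1 hc
    (le_form₁₁_of_le_form A B Bᴴ D (le_form_of_sub_smul_one_posSemidef hQ))

end Schur

/-! ## §3. `det Q = det A · det S` and the log-determinant volume law -/

section LogDet

variable {m n : Type*} [Fintype m] [Fintype n] [DecidableEq m] [DecidableEq n]

/-- `det [[A, B], [C, D]] = det A · det (D − C A⁻¹ B)` for positive definite `A` (Mathlib `det_fromBlocks₁₁`).
[folklore] -/
theorem det_fromBlocks₁₁_eq {A : Matrix m m ℝ} (hA : A.PosDef) (B : Matrix m n ℝ) (C : Matrix n m ℝ)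
    (D : Matrix n n ℝ) : (fromBlocks A B C D).det = A.det * (D - C * A⁻¹ * B).det := by
  letI : Invertible A := hA.isUnit.invertible
  rw [det_fromBlocks₁₁, invOf_eq_nonsing_inv]

/-- **The log-determinant volume law.**  For the symmetric block matrix `Q = [[A, B], [Bᴴ, D]]` with
`Q ⪰ c·1`, `0 < c`, and `D ⪯ a·1`:  `|log det Q − log det A| ≤ |n| · max(|log c|, |log a|)` — integrating out the
`|n|` non-core variables changes the log-determinant by at most a constant PER VARIABLE, whatever the coupling `B`.
[folklore] -/
theorem abs_log_det_fromBlocks_sub_log_det_le {A : Matrix m m ℝ} {B : Matrix m n ℝ} {D : Matrix n n ℝ}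
    {c a : ℝ} (hc : 0 < c) (hQ : (fromBlocks A B Bᴴ D - c • (1 : Matrix (m ⊕ n) (m ⊕ n) ℝ)).PosSemidef)
    (hD : (a • (1 : Matrix n n ℝ) - D).PosSemidef) :
    |Real.log (fromBlocks A B Bᴴ D).det - Real.log A.det| ≤ Fintype.card n * max |Real.log c| |Real.log a| := by
  have hQh : (fromBlocks A B Bᴴ D).IsHermitian := isHermitian_of_sub_smul_one_posSemidef hQ
  have hDh : D.IsHermitian := (isHermitian_fromBlocks_iff.mp hQh).2.2.2
  have hQform := le_form_of_sub_smul_one_posSemidef hQ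
  have hA : A.PosDef := posDef₁₁_of_sub_smul_one_posSemidef hc hQ
  have hSlo := le_form_schur₁₁ hA B D hc.le hQform
  have hShi := form_schur₁₁_le hA B D (form_le_of_smul_one_sub_posSemidef hD)
  have hSh : (D - Bᴴ * A⁻¹ * B).IsHermitian := hDh.sub (isHermitian_conjTranspose_mul_mul B hA.1.inv)
  have hSdet : 0 < (D - Bᴴ * A⁻¹ * B).det := det_pos_of_le_form hSh hc hSlo
  have hlog := abs_log_det_le_of_form_bounds hSh hc hSlo hShi
  rw [det_fromBlocks₁₁_eq hA B Bᴴ D, Real.log_mul hA.det_pos.ne' hSdet.ne', add_sub_cancel_left]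
  exact hlog

end LogDet

/-! ## §4. Gaussian normalisations over nested variable sets: the volume law -/

section Gaussian

variable {m n : Type*} [Fintype m] [Fintype n] [DecidableEq m] [DecidableEq n]

/-- `0 ≤ log 2π`. [folklore] -/
theorem log_two_pi_nonneg : 0 ≤ Real.log (2 * π) :=
  Real.log_nonneg (by linarith [Real.pi_gt_three])

/-- **Volume law for Gaussian normalisations, one-sided.**  For the symmetric block precision form
`Q = [[A, B], [Bᴴ, D]]` on `ℝ^{m ⊕ n}` with `Q ⪰ c·1` (`0 < c`) and `D ⪯ a·1`, the Gaussian normalisations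
`Z(Q) = ∫ e^{−½⟨v,Qv⟩}dv` and `Z(A) = ∫ e^{−½⟨x,Ax⟩}dx` (core variables only, the others set to zero) satisfy
`|log Z(Q) − log Z(A)| ≤ |n| · ½(log 2π + max(|log c|, |log a|))` — by
`Beta.GaussianIntegral.log_integral_exp_neg_half_quadForm` the difference is `(|n|/2) log 2π − ½ log det S`,
`S` the Schur complement. [folklore] -/
theorem abs_log_gaussian_fromBlocks_sub_le {A : Matrix m m ℝ} {B : Matrix m n ℝ} {D : Matrix n n ℝ} {c a : ℝ}
    (hc : 0 < c) (hQ : (fromBlocks A B Bᴴ D - c • (1 : Matrix (m ⊕ n) (m ⊕ n) ℝ)).PosSemidef)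
    (hD : (a • (1 : Matrix n n ℝ) - D).PosSemidef) :
    |Real.log (∫ v : m ⊕ n → ℝ, Real.exp (-(1/2 : ℝ) * (v ⬝ᵥ fromBlocks A B Bᴴ D *ᵥ v)))
        - Real.log (∫ x : m → ℝ, Real.exp (-(1/2 : ℝ) * (x ⬝ᵥ A *ᵥ x)))|
      ≤ Fintype.card n * ((Real.log (2 * π) + max |Real.log c| |Real.log a|) / 2) := by
  have hQpd : (fromBlocks A B Bᴴ D).PosDef :=
    posDef_of_le_form (isHermitian_of_sub_smul_one_posSemidef hQ) hc (le_form_of_sub_smul_one_posSemidef hQ)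
  have hA : A.PosDef := posDef₁₁_of_sub_smul_one_posSemidef hc hQ
  have hdet := abs_log_det_fromBlocks_sub_log_det_le hc hQ hD
  rw [GaussianIntegral.log_integral_exp_neg_half_quadForm _ hQpd,
    GaussianIntegral.log_integral_exp_neg_half_quadForm _ hA, Fintype.card_sum, Nat.cast_add]
  set δ : ℝ := Real.log (fromBlocks A B Bᴴ D).det - Real.log A.det with hδ
  set L : ℝ := Real.log (2 * π) with hL
  set μ : ℝ := max |Real.log c| |Real.log a| with hμ
  have hN : (0 : ℝ) ≤ Fintype.card n := Nat.cast_nonneg _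
  have hL0 : 0 ≤ L := log_two_pi_nonneg
  have key : ((Fintype.card m : ℝ) + Fintype.card n) / 2 * L - 1 / 2 * Real.log (fromBlocks A B Bᴴ D).det
      - ((Fintype.card m : ℝ) / 2 * L - 1 / 2 * Real.log A.det)
      = (Fintype.card n : ℝ) / 2 * L - 1 / 2 * δ := by rw [hδ]; ring
  rw [key]
  calc |(Fintype.card n : ℝ) / 2 * L - 1 / 2 * δ|
      ≤ |(Fintype.card n : ℝ) / 2 * L| + |1 / 2 * δ| := abs_sub _ _
    _ = (Fintype.card n : ℝ) / 2 * L + 1 / 2 * |δ| := by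
        rw [abs_mul, abs_mul, abs_of_nonneg (by positivity : (0 : ℝ) ≤ Fintype.card n / 2), abs_of_nonneg hL0,
          abs_of_nonneg (by norm_num : (0 : ℝ) ≤ 1 / 2)]
    _ ≤ (Fintype.card n : ℝ) / 2 * L + 1 / 2 * (Fintype.card n * μ) := by gcongr
    _ = Fintype.card n * ((L + μ) / 2) := by ring

/-- **Volume law for Gaussian normalisations with a common core** (the shape of C-adv9-28 (b)): two symmetric
precision forms `Q₁ = [[K, B₁], [B₁ᴴ, D₁]]` on `ℝ^{κ ⊕ n₁}` and `Q₂ = [[K, B₂], [B₂ᴴ, D₂]]` on `ℝ^{κ ⊕ n₂}` that AGREE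
on the common core `K` and satisfy `Qᵢ ⪰ c·1` (`0 < c`), `Dᵢ ⪯ a·1` have
`|log Z(Q₁) − log Z(Q₂)| ≤ (|n₁| + |n₂|) · ½(log 2π + max(|log c|, |log a|))` — through `Z(K)` by the one-sided law
twice.  Each non-core variable of either side costs a constant; the coupling blocks `B₁, B₂` do not enter.
[folklore] -/
theorem abs_log_gaussian_sub_le_of_commonCore {κ n₁ n₂ : Type*} [Fintype κ] [Fintype n₁] [Fintype n₂]
    [DecidableEq κ] [DecidableEq n₁] [DecidableEq n₂]
    {K : Matrix κ κ ℝ} {B₁ : Matrix κ n₁ ℝ} {D₁ : Matrix n₁ n₁ ℝ} {B₂ : Matrix κ n₂ ℝ} {D₂ : Matrix n₂ n₂ ℝ}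
    {c a : ℝ} (hc : 0 < c)
    (hQ₁ : (fromBlocks K B₁ B₁ᴴ D₁ - c • (1 : Matrix (κ ⊕ n₁) (κ ⊕ n₁) ℝ)).PosSemidef)
    (hD₁ : (a • (1 : Matrix n₁ n₁ ℝ) - D₁).PosSemidef)
    (hQ₂ : (fromBlocks K B₂ B₂ᴴ D₂ - c • (1 : Matrix (κ ⊕ n₂) (κ ⊕ n₂) ℝ)).PosSemidef)
    (hD₂ : (a • (1 : Matrix n₂ n₂ ℝ) - D₂).PosSemidef) :
    |Real.log (∫ v : κ ⊕ n₁ → ℝ, Real.exp (-(1/2 : ℝ) * (v ⬝ᵥ fromBlocks K B₁ B₁ᴴ D₁ *ᵥ v)))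
        - Real.log (∫ w : κ ⊕ n₂ → ℝ, Real.exp (-(1/2 : ℝ) * (w ⬝ᵥ fromBlocks K B₂ B₂ᴴ D₂ *ᵥ w)))|
      ≤ (Fintype.card n₁ + Fintype.card n₂) * ((Real.log (2 * π) + max |Real.log c| |Real.log a|) / 2) := by
  have h₁ := abs_log_gaussian_fromBlocks_sub_le hc hQ₁ hD₁
  have h₂ := abs_log_gaussian_fromBlocks_sub_le hc hQ₂ hD₂
  rw [abs_sub_comm] at h₂
  calc _ ≤ _ := abs_sub_le _ (Real.log (∫ x : κ → ℝ, Real.exp (-(1/2 : ℝ) * (x ⬝ᵥ K *ᵥ x)))) _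
    _ ≤ Fintype.card n₁ * ((Real.log (2 * π) + max |Real.log c| |Real.log a|) / 2)
        + Fintype.card n₂ * ((Real.log (2 * π) + max |Real.log c| |Real.log a|) / 2) := add_le_add h₁ h₂
    _ = _ := by ring

end Gaussian

/-! ## §5. The B10-facing discharge of the leaf `Norm35` modulo the located model hypotheses -/

section B10

variable {T : TowerRun} {k : ℕ}

/-- MODEL DATA for (35) at one level-(k+1) history `h` (k = 0: the small domain is Ω₁, its complement volume
`P.Zvol h = |Ω₁ᶜ|`; k ≥ 1: B(Λ_{k+1}) and |Z_k|) — the located HYPOTHESES under which the printed-but-unproved bound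
holds, exactly the shape of cell GAPS C-adv9-28 (b):

* the two printed numbers `log Z^{(k)}(small domain, 1)` = `P.logZ1 h` and `log Z^{(k)}(T₁^{(k)}, 1)` = `P.logZT` ARE
  a constant (`J₁`, `J₂`: the normalisations of the δ-function constraint elimination `A = CÃ`, cf. the tree's
  `Beta.ConstrainedGaussian.logZ_sub_logZred`) plus the logarithm of the Gaussian integral of a symmetric block
  precision form over (common core `Fin r` = the whole-lattice constrained fields supported in the small domain,
  C-adv9-28's `V′_T`) ⊕ (the side's own extra coordinates, `Fin s` resp. `Fin t`) — fields `logZ1_eq`, `logZT_eq`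
  (the IDENTIFICATION; the print does not define Z^{(0)}, cell GAPS G-B10-03);
* both forms lie in `[c, a]`: `lower₁`, `lower₂` (uniform positivity of the constrained quadratic form — C-adv9-28's
  named LEAF: [Balaban1985BackgroundPropagators] Thm. 3.11, cell GAPS G-B9-06/06a) and `upper₁`, `upper₂` (the
  difference operator `Δ(1)` is bounded; only the extra diagonal blocks are constrained from above);
* the UNPRINTED COUNTS (cell GAPS G-B10-07 (a)): `count_le` — the extra coordinates of both sides number at most
  `c_v·|Z_k|` (they sit on bonds of the complement and on coarse bonds meeting its boundary; the complement is a union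
  of big blocks) — and `jac_le` — the two constraint-elimination constants differ by at most `c_J·|Z_k|` (the
  δ-functions are per-coarse-bond local).

Nothing here is asserted; a term of this structure is what a construction of Bałaban's Z^{(k)} would have to supply.
[cite: Balaban1985UV3, (22) p.261 + (35) p.265] -/
structure Norm35Model (P : StepPieces T k) (c a cv cJ : ℝ) (h : T.Hist (k + 1)) where
  /-- dimension of the common core (`V′_T` of C-adv9-28 (b)) -/
  r : ℕ
  /-- number of extra coordinates on the small-domain side -/
  s : ℕ
  /-- number of extra coordinates on the whole-lattice side -/
  t : ℕ
  /-- the common core block of both precision forms -/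
  K : Matrix (Fin r) (Fin r) ℝ
  /-- coupling core × extra, small-domain side -/
  B₁ : Matrix (Fin r) (Fin s) ℝ
  /-- extra diagonal block, small-domain side -/
  D₁ : Matrix (Fin s) (Fin s) ℝ
  /-- coupling core × extra, whole-lattice side -/
  B₂ : Matrix (Fin r) (Fin t) ℝ
  /-- extra diagonal block, whole-lattice side -/
  D₂ : Matrix (Fin t) (Fin t) ℝ
  /-- constraint-elimination constant, small-domain side -/
  J₁ : ℝ
  /-- constraint-elimination constant, whole-lattice side -/
  J₂ : ℝ
  lower₁ : (fromBlocks K B₁ B₁ᴴ D₁ - c • (1 : Matrix (Fin r ⊕ Fin s) (Fin r ⊕ Fin s) ℝ)).PosSemidef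
  upper₁ : (a • (1 : Matrix (Fin s) (Fin s) ℝ) - D₁).PosSemidef
  lower₂ : (fromBlocks K B₂ B₂ᴴ D₂ - c • (1 : Matrix (Fin r ⊕ Fin t) (Fin r ⊕ Fin t) ℝ)).PosSemidef
  upper₂ : (a • (1 : Matrix (Fin t) (Fin t) ℝ) - D₂).PosSemidef
  logZ1_eq : P.logZ1 h = J₁ + Real.log (∫ v : Fin r ⊕ Fin s → ℝ,
    Real.exp (-(1/2 : ℝ) * (v ⬝ᵥ fromBlocks K B₁ B₁ᴴ D₁ *ᵥ v)))
  logZT_eq : P.logZT = J₂ + Real.log (∫ w : Fin r ⊕ Fin t → ℝ,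
    Real.exp (-(1/2 : ℝ) * (w ⬝ᵥ fromBlocks K B₂ B₂ᴴ D₂ *ᵥ w)))
  count_le : ((s : ℝ) + t) ≤ cv * P.Zvol h
  jac_le : |J₁ - J₂| ≤ cJ * P.Zvol h

/-- **(35) p. 265 and its unprinted k ≥ 1 analogue, given the model data** (the kernel execution of cell GAPS
C-adv9-28 (b)): if every level-(k+1) history carries `Norm35Model` data with form bounds `[c, a]` (`0 < c`) and
count constants `c_v`, `c_J` UNIFORM in the history, then the leaf `B10SectAGathering.Norm35` holds with the explicit
constant `c_v·(log 2π + max(|log c|, |log a|))/2 + c_J` — the printed «O(1)|Ω₁ᶜ|», with O(1) depending on the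
spectral bounds and the per-block counts only (no `g₀`, no locality of `log det`; cf. the corrected reasoning of
G-adv5-2 in C-adv9-28).  Re-derived bookkeeping; the model data are hypotheses.
[cite: Balaban1985UV3, (35) p.265] -/
theorem norm35_of_model {P : StepPieces T k} {c a cv cJ : ℝ} (hc : 0 < c)
    (𝓜 : ∀ h : T.Hist (k + 1), Norm35Model P c a cv cJ h) :
    Norm35 P (cv * ((Real.log (2 * π) + max |Real.log c| |Real.log a|) / 2) + cJ) := by
  intro h
  set u : ℝ := (Real.log (2 * π) + max |Real.log c| |Real.log a|) / 2 with hu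
  have hu0 : 0 ≤ u := by
    have h1 : 0 ≤ max |Real.log c| |Real.log a| := (abs_nonneg _).trans (le_max_left _ _)
    have h2 := log_two_pi_nonneg
    rw [hu]; positivity
  have M := 𝓜 h
  have hG := abs_log_gaussian_sub_le_of_commonCore hc M.lower₁ M.upper₁ M.lower₂ M.upper₂
  simp only [Fintype.card_fin] at hG
  have hZ := P.Zvol_nonneg h
  rw [M.logZ1_eq, M.logZT_eq]
  calc |M.J₁ + Real.log (∫ v : Fin M.r ⊕ Fin M.s → ℝ,
            Real.exp (-(1/2 : ℝ) * (v ⬝ᵥ fromBlocks M.K M.B₁ M.B₁ᴴ M.D₁ *ᵥ v)))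
          - (M.J₂ + Real.log (∫ w : Fin M.r ⊕ Fin M.t → ℝ,
            Real.exp (-(1/2 : ℝ) * (w ⬝ᵥ fromBlocks M.K M.B₂ M.B₂ᴴ M.D₂ *ᵥ w))))|
      = |(M.J₁ - M.J₂) + (Real.log (∫ v : Fin M.r ⊕ Fin M.s → ℝ,
            Real.exp (-(1/2 : ℝ) * (v ⬝ᵥ fromBlocks M.K M.B₁ M.B₁ᴴ M.D₁ *ᵥ v)))
          - Real.log (∫ w : Fin M.r ⊕ Fin M.t → ℝ,
            Real.exp (-(1/2 : ℝ) * (w ⬝ᵥ fromBlocks M.K M.B₂ M.B₂ᴴ M.D₂ *ᵥ w))))| := by ring_nf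
    _ ≤ |M.J₁ - M.J₂| + |Real.log (∫ v : Fin M.r ⊕ Fin M.s → ℝ,
            Real.exp (-(1/2 : ℝ) * (v ⬝ᵥ fromBlocks M.K M.B₁ M.B₁ᴴ M.D₁ *ᵥ v)))
          - Real.log (∫ w : Fin M.r ⊕ Fin M.t → ℝ,
            Real.exp (-(1/2 : ℝ) * (w ⬝ᵥ fromBlocks M.K M.B₂ M.B₂ᴴ M.D₂ *ᵥ w)))| := abs_add_le _ _
    _ ≤ cJ * P.Zvol h + ((M.s : ℝ) + M.t) * u := add_le_add M.jac_le hG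
    _ ≤ cJ * P.Zvol h + cv * P.Zvol h * u := by
        have := mul_le_mul_of_nonneg_right M.count_le hu0
        linarith
    _ = (cv * u + cJ) * P.Zvol h := by ring

end B10

end Literature.MathematicalPhysics.QuantumFieldTheory.Balaban1983to89.B10Eq35Norm

end
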